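import Summits.QuantumFields.YangMills.Theorems.UnitScaleTiltProp7TowerDPDstarPointRow
import Literature.MathematicalPhysics.QuantumFieldTheory.Balaban1983to89.B9Eq315QTowerFlat
import Literature.MathematicalPhysics.QuantumFieldTheory.Balaban1983to89.B9Eq326OperatorTowerFlat
import HarnessLib

/-!
# Route `UnitScaleTilt`, crux K1 «MinimiserStabilityRegPr» (stmt-QuantumFields-19200), stub `stub_existenceMinimalOrbit` (EX) — N06 print row `h349` of the EX display
# (S31ᴸ ✓p703595 :245–:250), FLAT-CERTIFICATE ROAD, FILE 2∕4 «FLAT TOWER DATUM»: **THE (3.49) ONE-BOND POINT ROW OF `D(1 − R_k(1))D*` AT THE FLAT TOWER BACKGROUND `U ≡ 1`,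
# `∃ (C, δ)` BEFORE THE HEIGHT, WITH EVERY WINDOW BINDER OF FILE 1 DISCHARGED BY NAME** — [Balaban1985BackgroundPropagators] (3.49) p. 399 at `U = 1`

Cell `ym3-torus`, width seat `ym3-torus-px20` (gen 6); ★★OWNER g30 WORD 5 ∕ ★w2-19200 g8 08:25:14Z GO (certificate class).  THEOREMS ONLY (0 `def`, 0 `sorry`);
`--supports stmt-QuantumFields-19200 --as helper`, count-neutral.  YM₃ on T³ is a ladder rung (R3), not the Clay problem; nothing here claims the displayed row `h349`
(curved `U₀ ∈ RegPr`), N06, the stub, the crux or the mass gap.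

WHAT IS PROVED (ns `Summit.QuantumFields.YangMills.Theorems.Prop7TowerDPDstarPointRowFlat`; [folklore] instantiation of FILE 1 ✓`exists_pointRow_DPDstar_tower` at the constant
background `fun _ ↦ 1`): ★★★`exists_pointRow_DPDstar_tower_one` — `∃ C δ`, `0 ≤ C`, `0 < δ`, such that for every height `n`, spacing `η` with `ηL^{n+1} = 1`, weights on the diagonal
`c₀(L^{n+1})^d = c₁` with `|η|^d∕c₀ ≤ ρw`, period `m`, fine bonds `b b′` and `z : W`:
`‖(D_1((1 − R_k(1))(D_1†(χ_b z))))(b′)‖ ≤ C·((L^{n+1})^d)⁻¹·e^{−δ·d_m(Π(b′₊), Π(b₊))}·‖z‖`.  The window binders of FILE 1 at `U := 1`, `α := 0`, `αU = εU := 0`, `ϱ := 0`, `AQ := 0`,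
`a := 1`: `hU1` ✓`B9Eq315QTowerFlat.perCfg_UlevOf_one_mem_U1`, `hreg` ✓`norm_Wcx_UlevOf_one_sub_one_le`, `hUε hLb hRlev` by ✓`UlevOf_one` (+ `Subgroup.one_mem`, ✓`adTransportW`
of `1` is the identity), `hUst hUb hUη hUgrad hεg hAQ` trivial at `1`, `hpl` ✓`plaqHolU_one`, `hpos′` ✓`B9Eq324DeltaPrimeATower.laplacePrimeAk_one_pos` (`η ≠ 0` from `ηL^{n+1} = 1`, `a′ > 0`).
HONEST SCOPE.  Instantiation only; constants `C δ` depend on `(d, L, a′, M_φ, M_φ′, C_τ, M_τ, ρ_w)`; nothing of (3.49) at curved backgrounds is discharged here (FILE 1 keeps it as a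
hypothesis-bearing row); rung R3, not Clay; YM gap NOT proved.

References: T. Bałaban, CMP **99** (1985) 389–434 [Balaban1985BackgroundPropagators] ((3.49) p.399, (3.25) p.394, Thm 3.11 p.416); CMP **98** (1985) 17–51 [Balaban1985Averaging]
((42)–(43) pp.23–24).
-/

noncomputable section

set_option autoImplicit false
open scoped InnerProductSpace ComplexConjugate BigOperators

namespace Summit.QuantumFields.YangMills.Theorems.Prop7TowerDPDstarPointRowFlat

open Literature.MathematicalPhysics.QuantumFieldTheory.Balaban1983to89
open B4Sect5Torus (TSite tdist)
open B9SectCLatticeCarrier (Bond btgt unshift)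
open B9Eq311L2Pairing (WL2)
open B9Eq319QprimeTorus (blockCoord)
open B7Prop1Explicit (U1)
open B11Eq103H1Complex (SiteL2K BondL2K covDerivL2K)
open B9Eq310DeltaPrime (plaqHolU plaqHolU_one)
open B9Eq310HessianOperator (adTransportW adTransportW_apply)
open B9Eq315QTower (towerP UlevOf)
open B9Eq315QTowerFlat (UlevOf_one perCfg_UlevOf_one_mem_U1 norm_Wcx_UlevOf_one_sub_one_le)
open B9Eq316TowerFlatIsOneStep (towerP_eq_fineP_pow siteCast)
open B9Eq326OperatorTower (RofUk)
open B9Eq324DeltaPrimeATower (laplacePrimeAk laplacePrimeAk_one_pos)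
open Summit.QuantumFields.YangMills.Theorems.Prop7TowerDPDstarPointRow (exists_pointRow_DPDstar_tower)

variable {d : ℕ} (hd : 1 ≤ d) (L : ℕ) [NeZero L] (hL : 1 ≤ L) (hL3 : 3 ≤ L)
  {𝔸 : Type*} [NormedRing 𝔸] [NormedAlgebra ℂ 𝔸] [CompleteSpace 𝔸] [NormOneClass 𝔸] [StarRing 𝔸] [NormedStarGroup 𝔸] [StarModule ℂ 𝔸]
  {W : Type*} [NormedAddCommGroup W] [InnerProductSpace ℂ W] [FiniteDimensional ℂ W] (φ : W ≃ₗ[ℂ] 𝔸)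
  {Mφ Mφ' : ℝ} (hMφ : 0 ≤ Mφ) (hMφ' : 0 ≤ Mφ') (hφ : ∀ w, ‖φ w‖ ≤ Mφ * ‖w‖) (hφ' : ∀ X, ‖φ.symm X‖ ≤ Mφ' * ‖X‖)
  {a' : ℝ} (ha' : 0 < a')
  (τ : 𝔸 →ₗ[ℂ] ℂ) {Cτ : ℝ} (hτ : ∀ X, ‖τ X‖ ≤ Cτ * ‖X‖) (hCτ : 0 ≤ Cτ) {Mτ : ℝ} (hMτ : 0 ≤ Mτ) {ρw : ℝ} (hρw : 0 ≤ ρw)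
  (hτ₁ : ∀ X : 𝔸, τ (star X) = conj (τ X)) (hτ₂ : ∀ X Y : 𝔸, τ (X * Y) = τ (Y * X)) (hφτ : ∀ X Y : 𝔸, ⟪φ.symm X, φ.symm Y⟫_ℂ = τ (star X * Y))

include hd hL hL3 hMφ hMφ' hφ hφ' ha' hτ hCτ hMτ hρw hτ₁ hτ₂ hφτ in
/-- ★★★ **THE (3.49) ONE-BOND POINT ROW AT THE FLAT TOWER BACKGROUND `U ≡ 1`, `∃ (C, δ)` BEFORE THE HEIGHT**: for every `n`, `η` with `ηL^{n+1} = 1`, weights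
`c₀(L^{n+1})^d = c₁` with `|η|^d∕c₀ ≤ ρw`, period `m`, fine bonds `b b′`, `z : W`:
`‖(D_1((1 − R_k(1))(D_1†(χ_b z))))(b′)‖ ≤ C·((L^{n+1})^d)⁻¹·e^{−δ·d_m(Π(b′₊), Π(b₊))}·‖z‖` — FILE 1 ✓`exists_pointRow_DPDstar_tower` at `U := 1` with every window binder
discharged by the flat tower dictionary (`UlevOf_one`, `perCfg_UlevOf_one_mem_U1`, `norm_Wcx_UlevOf_one_sub_one_le`, `plaqHolU_one`, `laplacePrimeAk_one_pos`).
[cite: Balaban1985BackgroundPropagators, (3.49) p.399, (3.25) p.394, Thm 3.11 p.416] -/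
theorem exists_pointRow_DPDstar_tower_one :
    ∃ C δ : ℝ, 0 ≤ C ∧ 0 < δ ∧
      ∀ (n : ℕ) (η : ℝ) (_hηL : η * (L : ℝ) ^ (n + 1) = 1) (c₀ c₁ : ℝ) [Fact (0 < c₀)] [Fact (0 < c₁)]
        (_hw : c₀ * ((L : ℝ) ^ (n + 1)) ^ d = c₁) (_hρ : |η| ^ d / c₀ ≤ ρw) (m : Fin d → ℕ) [∀ i, NeZero (m i)] (_hm : ∀ i, 1 ≤ m i)
        (b b' : Bond d (towerP L m (n + 1))) (z : W),
        ‖WL2.equiv ℂ (fun _ : Bond d (towerP L m (n + 1)) => c₀) W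
            (covDerivL2K ℂ c₀ ((η : ℂ))⁻¹ (adTransportW φ (fun _ : Bond d (towerP L m (n + 1)) => (1 : 𝔸ˣ)))
              (LinearMap.adjoint (covDerivL2K ℂ c₀ ((η : ℂ))⁻¹ (adTransportW φ (fun _ : Bond d (towerP L m (n + 1)) => (1 : 𝔸ˣ))))
                  ((WL2.linearEquiv ℂ ℂ (fun _ : Bond d (towerP L m (n + 1)) => c₀)).symm (Pi.single b z)) -
                RofUk L m n φ η (fun _ : Bond d (towerP L m (n + 1)) => (1 : 𝔸ˣ)) (c₀ := c₀)
                  (LinearMap.adjoint (covDerivL2K ℂ c₀ ((η : ℂ))⁻¹ (adTransportW φ (fun _ : Bond d (towerP L m (n + 1)) => (1 : 𝔸ˣ))))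
                    ((WL2.linearEquiv ℂ ℂ (fun _ : Bond d (towerP L m (n + 1)) => c₀)).symm (Pi.single b z))))) b'‖ ≤
          C * (((L : ℝ) ^ (n + 1)) ^ d)⁻¹ *
            Real.exp (-(δ * tdist m (blockCoord (L ^ (n + 1)) m (siteCast (towerP_eq_fineP_pow L m (n + 1)) (btgt b')))
              (blockCoord (L ^ (n + 1)) m (siteCast (towerP_eq_fineP_pow L m (n + 1)) (btgt b))))) * ‖z‖ := by
  obtain ⟨α₁, C, δ, hα₁, hC, hδ, H⟩ := exists_pointRow_DPDstar_tower hd L hL hL3 φ hMφ hMφ' hφ hφ' (a := 1) one_pos ha' (ϱ := 0) le_rfl one_pos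
    τ hτ hCτ hMτ hρw hτ₁ hτ₂ hφτ 0
  refine ⟨C, δ, hC, hδ, ?_⟩
  intro n η hηL c₀ c₁ _ _ hw hρ m _ hm b b' z
  have hη : η ≠ 0 := by
    intro h0; rw [h0, zero_mul] at hηL; exact zero_ne_one hηL
  have h1U : ∀ (j : ℕ) (bb : Bond d (towerP L m (j + 1))),
      UlevOf L m (n + 1) (fun _ : Bond d (towerP L m (n + 1)) => (1 : 𝔸ˣ)) j bb = 1 := fun j bb => by
    rw [UlevOf_one]
  exact H n η hηL c₀ c₁ hw hρ m hm (fun _ => 1) (fun _ => 0) (fun _ => le_rfl) (fun _ => by norm_num)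
    (perCfg_UlevOf_one_mem_U1 L m (n + 1)) (norm_Wcx_UlevOf_one_sub_one_le L m (n + 1) (fun _ => 0) (fun _ => le_rfl))
    (fun _ => 0) (fun _ => le_rfl) (fun j bb => by rw [h1U, Units.val_one, sub_self, norm_zero])
    (fun j bb => by rw [h1U]; exact (U1 𝔸).one_mem) 0 le_rfl hα₁.le
    (fun _ => by rw [Units.val_one, star_one, inv_one, Units.val_one]) (fun _ => (U1 𝔸).one_mem)
    (fun _ => by rw [Units.val_one, sub_self, norm_zero, zero_mul]) (fun p => by rw [plaqHolU_one, Units.val_one, sub_self, norm_zero, zero_mul])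
    (fun x μ => by rw [sub_self, norm_zero, zero_mul])
    (fun j bb w => by rw [UlevOf_one]; simp [adTransportW_apply])
    (fun j _ => by rw [zero_mul]) (by simp) (laplacePrimeAk_one_pos L m n φ η a' hη ha') b b' z

end Summit.QuantumFields.YangMills.Theorems.Prop7TowerDPDstarPointRowFlat

end
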